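import Summits.HodgeConjecture.HodgeConjecture.Theorems.F0P6aStubFROBRoofGeoWiring
import HarnessLib
import HarnessLib.Audit.LibrarySuggestionsDenyListCruxes

/-! Import notes («M-142a» (A): canonical bare header; the per-import commentary lives here):
* `Summits.HodgeConjecture.HodgeConjecture.Theorems.F0P6aStubFROBRoofGeoWiring` — ★ twin (LAST part; parts 1–3 ride the import) of tree `Lines/F0_P6a_StubFROBRoofGeoWiring.lean` 46cdc102588d6598 (1102 l.)
* `HarnessLib.Audit.LibrarySuggestionsDenyListCruxes` — «P-κ» carrier (LEAD «M-142d» (1); shim = root of this `Lines` module) -/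

/-! # F0_P6a_StubFROBRoofGeoWiring — NEXT EDITION = SHIM (★ re-home, IMPORT-ONLY; K6 L3 column, dealer LA3-plan (g5) PLAN v2 ∕ set of record v1k,
writer LA3-plan (g6)).  The 27 declaration commands of this workfile (namespace
`Summit.HodgeConjecture.HodgeConjecture.Cruxes.HLiu418.F0P6aStubFROBRoofGeoWiring` KEPT ⇒ identical fully-qualified names) now live in ★
`Theorems/F0P6aStubFROBRoofGeoWiringWiring.lean` (tree :1–:339) → ★ `Theorems/F0P6aStubFROBRoofGeoWiringAdapters.lean` (tree :340–:633) → ★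
`Theorems/F0P6aStubFROBRoofGeoWiringHoleDischargers.lean` (tree :634–:902) → ★ `Theorems/F0P6aStubFROBRoofGeoWiring.lean` (tree :903–:1102) — the tree
bytes of 46cdc102588d6598 split ×4 by the size lint at command-block seams (sections re-opened and their `variable`∕`open`∕`set_option` lines replayed
verbatim in later parts), with its `Lines/` imports switched to their ★ re-homes, 0 statement ∕ proof bytes changed (part 1: four closed-`Prop`
docstrings carry `(print: …)` for `[cite: …]`, LA-ref1 #R1 pre-cure).  This file only imports the last part (transitively all), so the module
`…Cruxes.HLiu418.Lines.F0_P6a_StubFROBRoofGeoWiring` keeps serving every name to its importers (Lines-tree importers: `F0_P6a_StubFROB` — each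
switches to the ★ module in its own twin ∕ shim).  It declares nothing.  Edition history stays in git; future changes are ★-side proposals on the
`Theorems/` parts.  HC_CM is proved only modulo the 7 printed citations (2 remaining named inputs hLiu418 = stmt-HodgeConjecture-24832, h413 =
stmt-HodgeConjecture-24833) until rung 0 closes; count-neutral (0 `sorry`, 0 socket, 0 declaration). -/
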